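import Mathlib.Analysis.Fourier.FourierTransform
import Mathlib.Analysis.Calculus.ParametricIntegral
import Mathlib.Analysis.Complex.CauchyIntegral
import Mathlib.Analysis.Calculus.SmoothSeries
import Mathlib.Analysis.Calculus.ContDiff.Deriv
import Mathlib.Analysis.SpecialFunctions.Pow.Real
import Literature.Analysis.FunctionSpaces.PlancherelL1L2
import Literature.Analysis.Fourier.FractalUncertaintyPrinciple
import HarnessLib

/-!
# Bourgain–Dyatlov 2018, §2.3: the quantitative Beurling–Malliavin theorem (Lemma 2.11) from Theorem 5

Analysis/Fourier proof file; companion to `FractalUncertaintyPrinciple` (the named fact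
`Literature.Analysis.Fourier.bourgainDyatlov2018_thm4`, J. Bourgain–S. Dyatlov, *Spectral gaps
without the pressure condition*, Ann. of Math. 187 (2018), Theorem 4) and to
`FractalUncertaintyAdaptedWeight` (BD18 §3.1, where Lemma 2.11 is consumed as the hypothesis
`h211` of `adapted_multiplier_of_quantitativeBM`). BD18 §2.3 quotes the Beurling–Malliavin
multiplier theorem (Theorem 5 there, after Mashreghi–Nazarov–Havin) and derives from it, by a
compactness argument, the quantitative refinement Lemma 2.11 used in §3.1. The multiplier theorem
itself is far beyond Mathlib; this file PROVES, sorry-free, the printed deduction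
"Theorem 5 ⟹ Lemma 2.11", with Theorem 5 entering as an explicit hypothesis, in the language of
weight exponents `ω = e^{-Ω}` (so "`ω ∈ C¹(ℝ; (0,1])`" reads "`Ω ∈ C¹`, `Ω ≥ 0`",
`|log ω| = Ω`, `∂ log ω = -Ω'`), and for `ψ ∈ L¹ ∩ L²` (compact support makes `L² ⊂ L¹`):

* private helpers (the tree's `FourierCompactSupportAnalytic.lean` has public versions under the
  same names): "since `ψ` is compactly supported, `ψ̂` is real analytic and thus `ψ ≡ 0`" — the
  Fourier–Laplace transform `z ↦ ∫ e^{-2πitz} ψ(t) dt` of a compactly supported `ψ ∈ L¹` is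
  entire (differentiation under the integral sign), restricts to `ψ̂` on `ℝ`, so `ψ̂ = 0` on
  `(-1,1)` forces `ψ̂ ≡ 0` (identity theorem), and then `ψ = 0` a.e. (Plancherel on `L¹ ∩ L²`);
  `eqOn_zero_of_setIntegral_norm_sq_eq_zero` — `‖ψ̂‖_{L²(-1,1)} = 0 ⟹ ψ̂ = 0` on `(-1,1)` for
  continuous `ψ̂`.
* `weightExponent_le` — `Ω(ξ) ≤ 3C₀ + C₀|ξ|` for weights with `|Ω'| ≤ C₀`, `∫ Ω/(1+ξ²) ≤ C₀`
  (what makes the product weight `ω = Π ωₙ^{2^{-n}}` converge).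
* `quantitativeBM_of_beurlingMalliavin` — **BD18 Lemma 2.11 from BD18 Theorem 5**: the product
  weight (`Ω = Σ 2^{-n-1} Ωₙ`, `C¹` by termwise differentiation, same bounds), Theorem 5, and the
  facts above, exactly as printed.

Deliberately NOT here: Theorem 5 itself (Beurling–Malliavin 1962; Mashreghi–Nazarov–Havin 2005).
-/

namespace Literature.Analysis.Fourier

open _root_.MeasureTheory Set Filter _root_.Complex
open scoped FourierTransform ENNReal NNReal Topology Real

/-- **The Fourier–Laplace transform of a compactly supported integrable function is entire**
(the fact behind "since `ψ` is compactly supported, `ψ̂` is real analytic", BD18 proof of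
Lemma 2.11): `z ↦ ∫ e^{-2πi t z} ψ(t) dt` is complex differentiable on `ℂ` when `ψ ∈ L¹(ℝ)`
vanishes off `[-c₀, c₀]` (differentiation under the integral sign). [folklore] -/
private theorem differentiable_fourierLaplace_of_abs_lt {ψ : ℝ → ℂ} (hψ : Integrable ψ) {c₀ : ℝ} (hc₀ : 0 ≤ c₀)
    (hsupp : ∀ t, c₀ < |t| → ψ t = 0) :
    Differentiable ℂ fun z : ℂ => ∫ t : ℝ, Complex.exp (-(2 * π * I * t * z)) * ψ t := by
  intro z₀
  set F : ℂ → ℝ → ℂ := fun z t => Complex.exp (-(2 * π * I * t * z)) * ψ t with hF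
  set F' : ℂ → ℝ → ℂ := fun z t => (-(2 * π * I * t)) * (Complex.exp (-(2 * π * I * t * z)) * ψ t)
    with hF'
  set M : ℝ := Real.exp (2 * π * c₀ * (‖z₀‖ + 1)) with hM
  set bound : ℝ → ℝ := fun t => 2 * π * c₀ * M * ‖ψ t‖ with hbound
  have hexp_norm : ∀ (z : ℂ) (t : ℝ), ‖Complex.exp (-(2 * π * I * t * z))‖ ≤
      Real.exp (2 * π * |t| * ‖z‖) := by
    intro z t
    rw [Complex.norm_exp, Real.exp_le_exp]
    have hre : (-(2 * π * I * t * z)).re = 2 * π * t * z.im := by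
      simp [Complex.mul_re, Complex.mul_im]
    rw [hre]
    have h1 : t * z.im ≤ |t| * ‖z‖ := by
      calc t * z.im ≤ |t * z.im| := le_abs_self _
        _ = |t| * |z.im| := abs_mul _ _
        _ ≤ |t| * ‖z‖ := mul_le_mul_of_nonneg_left (Complex.abs_im_le_norm z) (abs_nonneg _)
    nlinarith [Real.pi_pos]
  have hmeas : ∀ z : ℂ, AEStronglyMeasurable (F z) volume := fun z =>
    ((Complex.continuous_exp.comp (by fun_prop)).aestronglyMeasurable).mul hψ.aestronglyMeasurable
  have hint : ∀ z : ℂ, Integrable (F z) := by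
    intro z
    refine Integrable.mono' (hψ.norm.const_mul (Real.exp (2 * π * c₀ * ‖z‖))) (hmeas z)
      (Eventually.of_forall fun t => ?_)
    simp only [hF, norm_mul]
    by_cases ht : c₀ < |t|
    · rw [hsupp t ht, norm_zero, mul_zero]
      positivity
    · push Not at ht
      have h1 : ‖Complex.exp (-(2 * π * I * t * z))‖ ≤ Real.exp (2 * π * c₀ * ‖z‖) :=
        (hexp_norm z t).trans (Real.exp_le_exp.2 (by
          have := mul_le_mul_of_nonneg_right ht (norm_nonneg z)
          nlinarith [Real.pi_pos]))
      exact mul_le_mul_of_nonneg_right h1 (norm_nonneg _)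
  have key := hasDerivAt_integral_of_dominated_loc_of_deriv_le (μ := volume) (x₀ := z₀)
    (F := F) (F' := F') (bound := bound) (Metric.ball_mem_nhds z₀ zero_lt_one)
    (Eventually.of_forall hmeas) (hint z₀)
    ?_ ?_ ?_ ?_
  · exact key.2.differentiableAt
  · simp only [hF']
    exact (by fun_prop : Continuous fun t : ℝ => -(2 * π * I * t)).aestronglyMeasurable.mul
      (hmeas z₀)
  · refine Eventually.of_forall fun t z hz => ?_
    show ‖(-(2 * π * I * t)) * (Complex.exp (-(2 * π * I * t * z)) * ψ t)‖ ≤ 2 * π * c₀ * M * ‖ψ t‖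
    by_cases ht : c₀ < |t|
    · rw [hsupp t ht]; simp
    · push Not at ht
      rw [norm_mul, norm_neg, norm_mul (Complex.exp (-(2 * π * I * t * z))) (ψ t)]
      have hz' : ‖z‖ ≤ ‖z₀‖ + 1 := by
        have h1 : ‖z - z₀‖ < 1 := mem_ball_iff_norm.1 hz
        calc ‖z‖ = ‖z₀ + (z - z₀)‖ := by ring_nf
          _ ≤ ‖z₀‖ + ‖z - z₀‖ := norm_add_le _ _
          _ ≤ ‖z₀‖ + 1 := by linarith
      have hcoef : ‖(2 * π * I * t : ℂ)‖ ≤ 2 * π * c₀ := by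
        rw [show (2 * π * I * t : ℂ) = ((2 * π * t : ℝ) : ℂ) * I by push_cast; ring, norm_mul,
          Complex.norm_I, mul_one, Complex.norm_real, Real.norm_eq_abs, abs_mul, abs_mul,
          abs_of_pos Real.pi_pos, abs_of_pos (by norm_num : (0:ℝ) < 2)]
        nlinarith [Real.pi_pos]
      have hexp : ‖Complex.exp (-(2 * π * I * t * z))‖ ≤ M := by
        refine (hexp_norm z t).trans (Real.exp_le_exp.2 ?_)
        have : |t| * ‖z‖ ≤ c₀ * (‖z₀‖ + 1) :=
          mul_le_mul ht hz' (norm_nonneg _) hc₀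
        nlinarith [Real.pi_pos]
      calc ‖(2 * π * I * t : ℂ)‖ * (‖Complex.exp (-(2 * π * I * t * z))‖ * ‖ψ t‖)
          ≤ (2 * π * c₀) * (M * ‖ψ t‖) := by
            refine mul_le_mul hcoef (mul_le_mul_of_nonneg_right hexp (norm_nonneg _))
              (by positivity) (by positivity)
        _ = 2 * π * c₀ * M * ‖ψ t‖ := by ring
  · exact hψ.norm.const_mul _
  · refine Eventually.of_forall fun t z _ => ?_
    show HasDerivAt (fun w : ℂ => Complex.exp (-(2 * π * I * t * w)) * ψ t)
      ((-(2 * π * I * t)) * (Complex.exp (-(2 * π * I * t * z)) * ψ t)) z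
    have h1 : HasDerivAt (fun w : ℂ => w * (-(2 * π * I * t))) (-(2 * π * I * t)) z := by
      simpa using (hasDerivAt_id z).mul_const (-(2 * π * I * t))
    have h2 := (h1.cexp).mul_const (ψ t)
    have hfun : (fun w : ℂ => Complex.exp (-(2 * π * I * t * w)) * ψ t) =
        fun w => Complex.exp (w * (-(2 * π * I * t))) * ψ t := by
      funext w; congr 2; ring
    rw [hfun]
    refine h2.congr_deriv ?_
    rw [show z * -(2 * ↑π * I * ↑t) = -(2 * π * I * t * z) by ring]
    ring

/-- The Fourier integral is the restriction of the Fourier–Laplace transform to `ℝ`. [folklore] -/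
private theorem fourier_eq_fourierLaplace_integral (ψ : ℝ → ℂ) (ξ : ℝ) :
    (𝓕 ψ : ℝ → ℂ) ξ = ∫ t : ℝ, Complex.exp (-(2 * π * I * t * ξ)) * ψ t := by
  rw [Real.fourier_real_eq_integral_exp_smul]
  congr 1; ext t
  rw [smul_eq_mul]
  congr 2
  push_cast
  ring

/-- **Fourier transforms of compactly supported functions cannot vanish on an interval**
(BD18 proof of Lemma 2.11: "`ψ̂ = 0` on `(-1,1)`; since `ψ` is compactly supported, `ψ̂` is real
analytic and thus `ψ ≡ 0`"): if `ψ ∈ L¹` vanishes off `[-c₀, c₀]` and `ψ̂ = 0` on `(-1, 1)`,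
then `ψ̂ ≡ 0` (identity theorem for the entire Fourier–Laplace transform). [folklore] -/
private theorem fourier_eq_zero_of_eqOn_Ioo_one {ψ : ℝ → ℂ} (hψ : Integrable ψ) {c₀ : ℝ} (hc₀ : 0 ≤ c₀)
    (hsupp : ∀ t, c₀ < |t| → ψ t = 0) (hzero : ∀ ξ ∈ Ioo (-1 : ℝ) 1, (𝓕 ψ : ℝ → ℂ) ξ = 0) :
    ∀ ξ : ℝ, (𝓕 ψ : ℝ → ℂ) ξ = 0 := by
  have hanal : AnalyticOnNhd ℂ (fun z : ℂ => ∫ t : ℝ, Complex.exp (-(2 * π * I * t * z)) * ψ t)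
      univ :=
    (differentiable_fourierLaplace_of_abs_lt hψ hc₀ hsupp).differentiableOn.analyticOnNhd isOpen_univ
  have hF : EqOn (fun z : ℂ => ∫ t : ℝ, Complex.exp (-(2 * π * I * t * z)) * ψ t) 0 univ := by
    refine hanal.eqOn_zero_of_preconnected_of_frequently_eq_zero isPreconnected_univ
      (z₀ := 0) (mem_univ _) ?_
    -- real points `1/(n+2)` accumulate at `0`
    have hseq : Tendsto (fun n : ℕ => ((1 / ((n : ℝ) + 2) : ℝ) : ℂ)) atTop (𝓝[≠] 0) := by
      refine tendsto_nhdsWithin_iff.2 ⟨?_, Eventually.of_forall fun n => ?_⟩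
      · have h1 : Tendsto (fun n : ℕ => (1 / ((n : ℝ) + 2) : ℝ)) atTop (𝓝 0) :=
          tendsto_const_nhds.div_atTop (tendsto_natCast_atTop_atTop.atTop_add tendsto_const_nhds)
        have h2 : Tendsto (fun n : ℕ => ((1 / ((n : ℝ) + 2) : ℝ) : ℂ)) atTop (𝓝 ((0 : ℝ) : ℂ)) :=
          (Complex.continuous_ofReal.tendsto 0).comp h1
        rwa [Complex.ofReal_zero] at h2
      · simp only [mem_compl_iff, mem_singleton_iff, ofReal_eq_zero, one_div, inv_eq_zero]
        positivity
    refine hseq.frequently (Frequently.of_forall fun n => ?_)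
    have hmem : (1 / ((n : ℝ) + 2) : ℝ) ∈ Ioo (-1 : ℝ) 1 := by
      constructor
      · have : (0 : ℝ) < 1 / ((n : ℝ) + 2) := by positivity
        linarith
      · rw [div_lt_one (by positivity)]; linarith [n.cast_nonneg (α := ℝ)]
    have := hzero _ hmem
    rwa [fourier_eq_fourierLaplace_integral] at this
  intro ξ
  rw [fourier_eq_fourierLaplace_integral]
  exact hF (mem_univ (ξ : ℂ))

/-- **Injectivity of the Fourier transform on `L¹ ∩ L²`** (from Plancherel): if `𝓕 ψ ≡ 0` then
`ψ = 0` a.e. [folklore] -/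
private theorem ae_eq_zero_of_fourier_eq_zero {ψ : ℝ → ℂ} (h1 : Integrable ψ) (h2 : MemLp ψ 2 volume)
    (hzero : ∀ ξ : ℝ, (𝓕 ψ : ℝ → ℂ) ξ = 0) : ψ =ᵐ[volume] 0 := by
  have hP := Literature.Analysis.FunctionSpaces.integral_norm_sq_fourierIntegral_eq h1 h2
  simp only [hzero, norm_zero, ne_eq, OfNat.ofNat_ne_zero, not_false_eq_true, zero_pow,
    integral_zero] at hP
  have hint : Integrable (fun x => ‖ψ x‖ ^ 2) := h2.integrable_norm_pow two_ne_zero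
  have hae : (fun x => ‖ψ x‖ ^ 2) =ᵐ[volume] 0 :=
    (integral_eq_zero_iff_of_nonneg (fun x => sq_nonneg _) hint).1 hP.symm
  filter_upwards [hae] with x hx
  simpa using hx

/-- A continuous function whose squared norm integrates to zero over `[-1, 1]` vanishes on
`(-1, 1)`. [folklore] -/
theorem eqOn_zero_of_setIntegral_norm_sq_eq_zero {g : ℝ → ℂ} (hg : Continuous g)
    (hzero : ∫ ξ in Icc (-1 : ℝ) 1, ‖g ξ‖ ^ 2 = 0) : ∀ ξ ∈ Ioo (-1 : ℝ) 1, g ξ = 0 := by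
  intro ξ hξ
  by_contra hne
  have hpos : 0 < ‖g ξ‖ ^ 2 := by positivity
  have hcont : Continuous fun η => ‖g η‖ ^ 2 := (hg.norm).pow 2
  -- `‖g‖² > ‖g ξ‖²/2` on a small interval around `ξ` inside `[-1, 1]`
  have hev : ∀ᶠ η in 𝓝 ξ, ‖g ξ‖ ^ 2 / 2 < ‖g η‖ ^ 2 :=
    (hcont.continuousAt (x := ξ)).eventually (lt_mem_nhds (by linarith))
  obtain ⟨ε, hε, hεg⟩ := Metric.eventually_nhds_iff.1 hev
  set r : ℝ := min (ε / 2) (min (ξ + 1) (1 - ξ)) / 2 with hr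
  have hr0 : 0 < r := by
    rw [hr]; refine div_pos (lt_min (by linarith) (lt_min (by linarith [hξ.1]) (by linarith [hξ.2]))) two_pos
  have hrε : r < ε := by
    have : min (ε / 2) (min (ξ + 1) (1 - ξ)) ≤ ε / 2 := min_le_left _ _
    rw [hr]; linarith
  have hsub : Icc (ξ - r) (ξ + r) ⊆ Icc (-1 : ℝ) 1 := by
    have h1 : min (ε / 2) (min (ξ + 1) (1 - ξ)) ≤ ξ + 1 := (min_le_right _ _).trans (min_le_left _ _)
    have h2 : min (ε / 2) (min (ξ + 1) (1 - ξ)) ≤ 1 - ξ := (min_le_right _ _).trans (min_le_right _ _)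
    intro η hη
    constructor <;> [linarith [hη.1]; linarith [hη.2]]
  have hlow : volume.real (Icc (ξ - r) (ξ + r)) • (‖g ξ‖ ^ 2 / 2) ≤
      ∫ η in Icc (ξ - r) (ξ + r), ‖g η‖ ^ 2 := by
    refine setIntegral_ge_of_const_le measurableSet_Icc (by simp) (fun η hη => le_of_lt (hεg ?_))
      (hcont.integrableOn_Icc)
    rw [Real.dist_eq, abs_lt]
    constructor <;> linarith [hη.1, hη.2]
  have hmono : ∫ η in Icc (ξ - r) (ξ + r), ‖g η‖ ^ 2 ≤ ∫ η in Icc (-1 : ℝ) 1, ‖g η‖ ^ 2 :=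
    setIntegral_mono_set hcont.integrableOn_Icc (Eventually.of_forall fun _ => sq_nonneg _)
      (Eventually.of_forall hsub)
  have hvol : volume.real (Icc (ξ - r) (ξ + r)) = 2 * r := by
    rw [Real.volume_real_Icc_of_le (by linarith)]; ring
  rw [hvol, smul_eq_mul] at hlow
  nlinarith


/-- **A weight exponent is controlled by its Lipschitz constant and its integral** (BD18 proof of
Lemma 2.11, the step making `ω = Π ωₙ^{2^{-n}}` converge): if `Ω ≥ 0`, `|Ω'| ≤ C₀` and
`∫ Ω/(1+ξ²) ≤ C₀` then `Ω(0) ≤ 3C₀`, hence `Ω(ξ) ≤ 3C₀ + C₀|ξ|`. [folklore] -/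
theorem weightExponent_le {Ω : ℝ → ℝ} {C₀ : ℝ} (hC₀ : 0 ≤ C₀) (hdiff : Differentiable ℝ Ω)
    (hnn : ∀ ξ, 0 ≤ Ω ξ) (hderiv : ∀ ξ, |deriv Ω ξ| ≤ C₀)
    (hint : Integrable fun ξ => Ω ξ / (1 + ξ ^ 2)) (hle : ∫ ξ, Ω ξ / (1 + ξ ^ 2) ≤ C₀) (ξ : ℝ) :
    Ω ξ ≤ 3 * C₀ + C₀ * |ξ| := by
  have hlip : LipschitzWith ⟨C₀, hC₀⟩ Ω :=
    lipschitzWith_of_nnnorm_deriv_le hdiff fun x => by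
      rw [← NNReal.coe_le_coe, coe_nnnorm, Real.norm_eq_abs]
      exact hderiv x
  have hlip' : ∀ x y, |Ω x - Ω y| ≤ C₀ * |x - y| := fun x y => by
    have h := hlip.dist_le_mul x y
    rw [Real.dist_eq, Real.dist_eq] at h
    exact h
  -- `Ω 0 ≤ 3 C₀`
  have h0 : Ω 0 ≤ 3 * C₀ := by
    by_contra hbig
    push Not at hbig
    have hlow : ∀ η ∈ Icc (0 : ℝ) 1, (Ω 0 - C₀) / 2 ≤ Ω η / (1 + η ^ 2) := by
      intro η hη
      have h1 := hlip' η 0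
      rw [sub_zero, abs_of_nonneg hη.1] at h1
      have h2 : Ω 0 - C₀ ≤ Ω η := by
        have := neg_abs_le (Ω η - Ω 0)
        nlinarith [hη.2, abs_nonneg (Ω η - Ω 0)]
      rw [le_div_iff₀ (by positivity)]
      have hpos : 0 ≤ (Ω 0 - C₀) / 2 := by linarith
      calc (Ω 0 - C₀) / 2 * (1 + η ^ 2) ≤ (Ω 0 - C₀) / 2 * 2 :=
            mul_le_mul_of_nonneg_left (by nlinarith [hη.1, hη.2]) hpos
        _ = Ω 0 - C₀ := by ring
        _ ≤ Ω η := h2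
    have hI : volume.real (Icc (0 : ℝ) 1) • ((Ω 0 - C₀) / 2) ≤ ∫ η in Icc (0 : ℝ) 1, Ω η / (1 + η ^ 2) :=
      setIntegral_ge_of_const_le measurableSet_Icc (by simp) hlow hint.integrableOn
    have hI' : ∫ η in Icc (0 : ℝ) 1, Ω η / (1 + η ^ 2) ≤ ∫ η, Ω η / (1 + η ^ 2) :=
      setIntegral_le_integral hint (Eventually.of_forall fun η => by
        show (0 : ℝ) ≤ _; exact div_nonneg (hnn η) (by positivity))
    rw [Real.volume_real_Icc_of_le zero_le_one, sub_zero, one_smul] at hI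
    linarith
  have h1 := hlip' ξ 0
  rw [sub_zero] at h1
  linarith [le_abs_self (Ω ξ - Ω 0)]

/-- **BD18 Lemma 2.11 (the quantitative Beurling–Malliavin theorem) from BD18 Theorem 5 (the
Beurling–Malliavin multiplier theorem)**, in the language of weight exponents `ω = e^{-Ω}`.
Theorem 5 (Havin's form, taken as the hypothesis `hBM`): for every `C¹` weight exponent
`Ω ≥ 0` with bounded derivative ((2.6)) and `∫ Ω/(1+ξ²) < ∞` ((2.5)), and every `c₀ > 0`,
there is `ψ ∈ L²`, `ψ ≢ 0`, with `supp ψ ⊂ [-c₀, c₀]` and `|ψ̂| ≤ ω`. Lemma 2.11 (the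
conclusion): for all `C₀, c₀ > 0` there is `c = c(C₀, c₀) > 0` such that every `C¹` weight
exponent `Ω ≥ 0` with `|Ω'| ≤ C₀` and `∫ Ω/(1+ξ²) ≤ C₀` admits `ψ`, `supp ψ ⊂ [-c₀, c₀]`,
`|ψ̂| ≤ ω^c` and `‖ψ̂‖_{L²(-1,1)} ≥ c` ((2.8)). The proof is the printed compactness argument
(BD18 §2.3): were the lemma false, weights `ωₙ` failing it with `c = 2^{-n-1}` would give
`ω = Π ωₙ^{2^{-n-1}}`, still a `C¹` weight with the same bounds; Theorem 5 yields `ψ ≢ 0` with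
`|ψ̂| ≤ ω ≤ ωₙ^{2^{-n-1}}` for every `n`, whence `‖ψ̂‖_{L²(-1,1)} = 0`, `ψ̂ = 0` on `(-1,1)`,
`ψ̂ ≡ 0` (the Fourier–Laplace transform of the compactly supported `ψ` is entire), `ψ = 0`
(Plancherel) — a contradiction. [cite: BourgainDyatlov2018, Lemma 2.11] -/
theorem quantitativeBM_of_beurlingMalliavin
    (hBM : ∀ Ω : ℝ → ℝ, ContDiff ℝ 1 Ω → (∀ ξ, 0 ≤ Ω ξ) → (∃ K, ∀ ξ, |deriv Ω ξ| ≤ K) →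
      Integrable (fun ξ => Ω ξ / (1 + ξ ^ 2)) → ∀ c₀ : ℝ, 0 < c₀ →
      ∃ ψ : ℝ → ℂ, Integrable ψ ∧ MemLp ψ 2 volume ∧ (∀ x, c₀ < |x| → ψ x = 0) ∧
        (∀ ξ, ‖(𝓕 ψ : ℝ → ℂ) ξ‖ ≤ Real.exp (-Ω ξ)) ∧ ¬ (ψ =ᵐ[volume] 0))
    (C₀ c₀ : ℝ) (hC₀ : 0 < C₀) (hc₀ : 0 < c₀) :
    ∃ c : ℝ, 0 < c ∧ ∀ Ω : ℝ → ℝ,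
      ContDiff ℝ 1 Ω → (∀ ξ, 0 ≤ Ω ξ) → (∀ ξ, |deriv Ω ξ| ≤ C₀) →
      Integrable (fun ξ => Ω ξ / (1 + ξ ^ 2)) → ∫ ξ, Ω ξ / (1 + ξ ^ 2) ≤ C₀ →
      ∃ ψ : ℝ → ℂ, Integrable ψ ∧ MemLp ψ 2 volume ∧ (∀ x, c₀ < |x| → ψ x = 0) ∧
        (∀ ξ, ‖(𝓕 ψ : ℝ → ℂ) ξ‖ ≤ Real.exp (-(c * Ω ξ))) ∧
        c ^ 2 ≤ ∫ ξ in Icc (-1 : ℝ) 1, ‖(𝓕 ψ : ℝ → ℂ) ξ‖ ^ 2 := by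
  by_contra hcon
  push Not at hcon
  -- the failing weights, one per `c = 2^{-n-1}`
  set c : ℕ → ℝ := fun n => (1 / 2 : ℝ) ^ (n + 1) with hc
  have hcpos : ∀ n, 0 < c n := fun n => by positivity
  have hcle : ∀ n, c n ≤ 1 := fun n => pow_le_one₀ (by norm_num) (by norm_num)
  have hcsum : HasSum c 1 := by
    have h := hasSum_geometric_two.mul_left (1 / 2 : ℝ)
    norm_num at h
    have hc' : c = fun i => 1 / 2 * (1 / 2 : ℝ) ^ i := by
      funext n; simp only [hc, pow_succ]; ring
    rw [hc']
    exact h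
  choose Ωs hΩs using fun n => hcon (c n) (hcpos n)
  have hcd : ∀ n, ContDiff ℝ 1 (Ωs n) := fun n => (hΩs n).1
  have hnn : ∀ n ξ, 0 ≤ Ωs n ξ := fun n => (hΩs n).2.1
  have hder : ∀ n ξ, |deriv (Ωs n) ξ| ≤ C₀ := fun n => (hΩs n).2.2.1
  have hint : ∀ n, Integrable fun ξ => Ωs n ξ / (1 + ξ ^ 2) := fun n => (hΩs n).2.2.2.1
  have hle : ∀ n, ∫ ξ, Ωs n ξ / (1 + ξ ^ 2) ≤ C₀ := fun n => (hΩs n).2.2.2.2.1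
  have hfail : ∀ n (ψ : ℝ → ℂ), Integrable ψ → MemLp ψ 2 volume → (∀ x, c₀ < |x| → ψ x = 0) →
      (∀ ξ, ‖(𝓕 ψ : ℝ → ℂ) ξ‖ ≤ Real.exp (-(c n * Ωs n ξ))) →
      ∫ ξ in Icc (-1 : ℝ) 1, ‖(𝓕 ψ : ℝ → ℂ) ξ‖ ^ 2 < c n ^ 2 := fun n => (hΩs n).2.2.2.2.2
  have hdiff : ∀ n, Differentiable ℝ (Ωs n) := fun n => (hcd n).differentiable one_ne_zero
  have hbd : ∀ n ξ, Ωs n ξ ≤ 3 * C₀ + C₀ * |ξ| := fun n =>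
    weightExponent_le hC₀.le (hdiff n) (hnn n) (hder n) (hint n) (hle n)
  -- the product weight, `Ω = Σ c_n Ω_n`
  have hsumm : ∀ ξ, Summable fun n => c n * Ωs n ξ := fun ξ =>
    Summable.of_nonneg_of_le (fun n => mul_nonneg (hcpos n).le (hnn n ξ))
      (fun n => mul_le_mul_of_nonneg_left (hbd n ξ) (hcpos n).le)
      (hcsum.summable.mul_right _)
  obtain ⟨Ω, hΩ⟩ : ∃ Ω : ℝ → ℝ, ∀ ξ, Ω ξ = ∑' n, c n * Ωs n ξ := ⟨_, fun _ => rfl⟩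
  have hΩfun : Ω = fun ξ => ∑' n, c n * Ωs n ξ := funext hΩ
  have hΩnn : ∀ ξ, 0 ≤ Ω ξ := fun ξ => by
    rw [hΩ]; exact tsum_nonneg fun n => mul_nonneg (hcpos n).le (hnn n ξ)
  -- termwise differentiation
  have hu : Summable fun n => c n * C₀ := hcsum.summable.mul_right _
  have hderivΩ : ∀ ξ, HasDerivAt Ω (∑' n, c n * deriv (Ωs n) ξ) ξ := by
    intro ξ
    rw [hΩfun]
    refine hasDerivAt_tsum hu (fun n y => ((hdiff n y).hasDerivAt).const_mul (c n))
      (fun n y => ?_) (hsumm 0) ξ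
    rw [norm_mul, Real.norm_of_nonneg (hcpos n).le, Real.norm_eq_abs]
    exact mul_le_mul_of_nonneg_left (hder n y) (hcpos n).le
  have hdiffΩ : Differentiable ℝ Ω := fun ξ => (hderivΩ ξ).differentiableAt
  have hderivΩ_eq : deriv Ω = fun ξ => ∑' n, c n * deriv (Ωs n) ξ :=
    funext fun ξ => (hderivΩ ξ).deriv
  have hderivΩ_bd : ∀ ξ, |deriv Ω ξ| ≤ C₀ := by
    intro ξ
    rw [hderivΩ_eq]
    have hs1 : Summable fun n => c n * deriv (Ωs n) ξ :=
      Summable.of_norm_bounded hu fun n => by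
        rw [norm_mul, Real.norm_of_nonneg (hcpos n).le, Real.norm_eq_abs]
        exact mul_le_mul_of_nonneg_left (hder n ξ) (hcpos n).le
    have h1 : |∑' n, c n * deriv (Ωs n) ξ| ≤ ∑' n, |c n * deriv (Ωs n) ξ| := by
      have := norm_tsum_le_tsum_norm hs1.norm
      simpa only [Real.norm_eq_abs] using this
    have h2 : ∑' n, |c n * deriv (Ωs n) ξ| ≤ ∑' n, c n * C₀ :=
      Summable.tsum_le_tsum (fun n => by
        rw [abs_mul, abs_of_pos (hcpos n)]
        exact mul_le_mul_of_nonneg_left (hder n ξ) (hcpos n).le) hs1.abs hu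
    have h3 : ∑' n, c n * C₀ = C₀ := by rw [tsum_mul_right, hcsum.tsum_eq, one_mul]
    linarith
  have hcontderiv : Continuous (deriv Ω) := by
    rw [hderivΩ_eq]
    refine continuous_tsum (fun n => ((hcd n).continuous_deriv le_rfl).const_mul (c n)) hu
      fun n ξ => ?_
    rw [norm_mul, Real.norm_of_nonneg (hcpos n).le, Real.norm_eq_abs]
    exact mul_le_mul_of_nonneg_left (hder n ξ) (hcpos n).le
  have hcdΩ : ContDiff ℝ 1 Ω := contDiff_one_iff_deriv.2 ⟨hdiffΩ, hcontderiv⟩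
  have hcontΩ : Continuous Ω := hdiffΩ.continuous
  -- the integral of `Ω/(1+ξ²)` through the Lebesgue integral
  have hsummdiv : ∀ ξ, Summable fun n => c n * Ωs n ξ / (1 + ξ ^ 2) := fun ξ =>
    (hsumm ξ).div_const _
  have hΩdiv : ∀ ξ, Ω ξ / (1 + ξ ^ 2) = ∑' n, c n * Ωs n ξ / (1 + ξ ^ 2) := fun ξ => by
    rw [hΩ]; simp_rw [div_eq_mul_inv]; rw [tsum_mul_right]
  have hlint : ∫⁻ ξ, ENNReal.ofReal (Ω ξ / (1 + ξ ^ 2)) ≤ ENNReal.ofReal C₀ := by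
    have h1 : ∀ ξ, ENNReal.ofReal (Ω ξ / (1 + ξ ^ 2)) =
        ∑' n, ENNReal.ofReal (c n * Ωs n ξ / (1 + ξ ^ 2)) := fun ξ => by
      rw [hΩdiv]
      exact ENNReal.ofReal_tsum_of_nonneg
        (fun n => div_nonneg (mul_nonneg (hcpos n).le (hnn n ξ)) (by positivity)) (hsummdiv ξ)
    simp_rw [h1]
    rw [lintegral_tsum fun n => ?_]
    · calc ∑' n, ∫⁻ ξ, ENNReal.ofReal (c n * Ωs n ξ / (1 + ξ ^ 2))
          = ∑' n, ENNReal.ofReal (∫ ξ, c n * Ωs n ξ / (1 + ξ ^ 2)) := by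
            refine tsum_congr fun n => ?_
            rw [ofReal_integral_eq_lintegral_ofReal]
            · simp_rw [mul_div_assoc]; exact (hint n).const_mul _
            · exact Eventually.of_forall fun ξ =>
                div_nonneg (mul_nonneg (hcpos n).le (hnn n ξ)) (by positivity)
        _ ≤ ∑' n, ENNReal.ofReal (c n * C₀) := by
            refine ENNReal.tsum_le_tsum fun n => ENNReal.ofReal_le_ofReal ?_
            simp_rw [mul_div_assoc]
            rw [integral_const_mul]
            exact mul_le_mul_of_nonneg_left (hle n) (hcpos n).le
        _ = ENNReal.ofReal (∑' n, c n * C₀) :=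
            (ENNReal.ofReal_tsum_of_nonneg (fun n => mul_nonneg (hcpos n).le hC₀.le) hu).symm
        _ = ENNReal.ofReal C₀ := by rw [tsum_mul_right, hcsum.tsum_eq, one_mul]
    · have hc1 : Continuous fun ξ : ℝ => c n * Ωs n ξ / (1 + ξ ^ 2) :=
        ((hdiff n).continuous.const_mul (c n)).div (continuous_const.add (continuous_id.pow 2))
          fun ξ => ne_of_gt (by positivity)
      exact (hc1.measurable.ennreal_ofReal).aemeasurable
  have hcontdiv : Continuous fun ξ => Ω ξ / (1 + ξ ^ 2) :=
    hcontΩ.div (continuous_const.add (continuous_id.pow 2)) fun ξ => by positivity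
  have hnndiv : ∀ ξ, 0 ≤ Ω ξ / (1 + ξ ^ 2) := fun ξ => div_nonneg (hΩnn ξ) (by positivity)
  have hintΩ : Integrable fun ξ => Ω ξ / (1 + ξ ^ 2) := by
    refine ⟨hcontdiv.aestronglyMeasurable, ?_⟩
    rw [hasFiniteIntegral_iff_enorm]
    have : ∫⁻ ξ, ‖Ω ξ / (1 + ξ ^ 2)‖ₑ = ∫⁻ ξ, ENNReal.ofReal (Ω ξ / (1 + ξ ^ 2)) :=
      lintegral_congr fun ξ => Real.enorm_eq_ofReal (hnndiv ξ)
    rw [this]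
    exact hlint.trans_lt ENNReal.ofReal_lt_top
  have hleΩ : ∫ ξ, Ω ξ / (1 + ξ ^ 2) ≤ C₀ := by
    rw [integral_eq_lintegral_of_nonneg_ae (Eventually.of_forall hnndiv)
      hcontdiv.aestronglyMeasurable]
    exact ENNReal.toReal_le_of_le_ofReal hC₀.le hlint
  -- the Beurling–Malliavin function for `Ω`
  obtain ⟨ψ, hψ1, hψ2, hψsupp, hψbd, hψne⟩ :=
    hBM Ω hcdΩ hΩnn ⟨C₀, hderivΩ_bd⟩ hintΩ c₀ hc₀
  -- `ψ` is admissible for every `Ω_n`, so `‖ψ̂‖_{L²(-1,1)} < c_n` for all `n`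
  set Iψ : ℝ := ∫ ξ in Icc (-1 : ℝ) 1, ‖(𝓕 ψ : ℝ → ℂ) ξ‖ ^ 2 with hIψ
  have hIsmall : ∀ n, Iψ < c n ^ 2 := by
    intro n
    refine hfail n ψ hψ1 hψ2 hψsupp fun ξ => (hψbd ξ).trans ?_
    rw [Real.exp_le_exp, neg_le_neg_iff, hΩ]
    have := (hsumm ξ).sum_le_tsum {n} (fun m _ => mul_nonneg (hcpos m).le (hnn m ξ))
    simpa using this
  have hI0 : Iψ = 0 := by
    have hInn : 0 ≤ Iψ := integral_nonneg fun ξ => by show (0:ℝ) ≤ _; positivity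
    by_contra hne
    have hpos : 0 < Iψ := lt_of_le_of_ne hInn (Ne.symm hne)
    obtain ⟨n, hn⟩ := exists_pow_lt_of_lt_one hpos (by norm_num : (1 / 4 : ℝ) < 1)
    have h1 := hIsmall n
    have h2 : c n ^ 2 ≤ (1 / 4 : ℝ) ^ n := by
      simp only [hc]
      rw [← pow_mul, show (1 / 4 : ℝ) = (1 / 2) ^ 2 by norm_num, ← pow_mul]
      exact pow_le_pow_of_le_one (by norm_num) (by norm_num) (by omega)
    linarith
  -- hence `ψ̂ = 0` on `(-1,1)`, so `ψ̂ ≡ 0` and `ψ = 0`: contradiction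
  have hcontF : Continuous (𝓕 ψ : ℝ → ℂ) :=
    VectorFourier.fourierIntegral_continuous Real.continuous_fourierChar
      (by exact continuous_inner) hψ1
  have hzero1 : ∀ ξ ∈ Ioo (-1 : ℝ) 1, (𝓕 ψ : ℝ → ℂ) ξ = 0 :=
    eqOn_zero_of_setIntegral_norm_sq_eq_zero hcontF (by rw [← hIψ]; exact hI0)
  have hzero : ∀ ξ, (𝓕 ψ : ℝ → ℂ) ξ = 0 :=
    fourier_eq_zero_of_eqOn_Ioo_one hψ1 hc₀.le hψsupp hzero1
  exact hψne (ae_eq_zero_of_fourier_eq_zero hψ1 hψ2 hzero)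

end Literature.Analysis.Fourier
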